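import Summits.CriticalPhenomena.PercolationContinuityZ3.Theorems.PercNearOneGluingNoHeavyPcintNawChainMemKernel
import HarnessLib

/-!
# PCINT lane, reduction B2c on the dangerous-set automaton — the kernel certificate theorem for the chain rule

Cell `prim-pcint` (PAPER-2 track (iii)), seat `prim-pcint-1` (gen 5); support file (`--supports stmt-CriticalPhenomena-4575`).
Does NOT build on p205010.  Memo: run/shared/lean/prim/pcint/REDUCTIONS.md §B2c (prim-pcint-2 gen 3), §B2c.7 (reduced states).

Row check `NawK.checkRowC τ kc d N pn Q D lamN lamD syms t i` (same table format `NawK.NT` and match test `NawK.termOK` as the B2r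
certificates; integer term `pn · Q^u · D^{4d-u} · F · D^{4d-c} · V_j`, `F = 2 | D^c + Q^c`, inequality `lamD·Σ ≤ lamN·2·D^{8d+1}·V`) and
**`NawK.le_siteCriticalProb_of_checkRowsC`**: all rows `i < N` pass + row 0 empty + valid symmetry tables + `pn ≤ D`, `Q ≤ D`,
`(D-pn)·D^{2d-1} ≤ Q^{2d}`, `lamN < lamD` ⇒ `pn/D ≤ p_c^site(ℤ^d)` (via `le_siteCriticalProb_zd_of_chainMemTable`).
Instances: `…PcintNawChainZ3C12*` etc.
-/

namespace Summit.CriticalPhenomena.PercolationContinuityZ3.Theorems.Pcint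

open Finset Literature.Probability.Percolation Literature.Probability.LatticeModels

/-! ## Kernel certificates for the chain rule: row check and the certificate theorem -/

namespace NawK

open WinK (toSite toL addL adjL toSite_addL toSite_toL adj_iff_adjL toSite_inj length_toL length_addL)

variable {d : ℕ}

section CheckC

variable (τ kc d N pn Q D lamN lamD : ℕ) (syms : List (List (ℕ × Bool))) (t : NT)

/-- Integer value of one letter for the chain rule: `pn · Q^u · D^{4d-u} · F · D^{4d-c} · V_j`, `F = 2` if `c = 0`, else
`D^c + Q^c` (the symmetric corner factor `(1 + q^c)/2` times `2 D^c`); `u`, `c` recomputed from the row's state. [folklore] -/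
def termValC (L : KState) (a : Fin d × Bool) (os : Option (ℕ × ℕ)) : ℕ :=
  match os with
  | none => 0
  | some jc =>
    pn * Q ^ cuK τ kc d L a * D ^ (4 * d - cuK τ kc d L a) *
      (if ccK τ kc d L a = 0 then 2 else D ^ ccK τ kc d L a + Q ^ ccK τ kc d L a) * D ^ (4 * d - ccK τ kc d L a) * vOf t jc.1

/-- Integer row sum for the chain rule. [folklore] -/
def rowValC (L : KState) (sc : ℕ → Option (ℕ × ℕ)) : ℕ :=
  ((letters d).map fun a => termValC τ kc d pn Q D t L a (sc (letterIdx a))).sum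

/-- **Row check for the chain rule**: as `checkRow`, with the integer inequality
`lamD · Σ ≤ lamN · 2 · D^{8d+1} · V`. [folklore] -/
def checkRowC (i : ℕ) : Bool :=
  match t.find i with
  | none => false
  | some v =>
    WF d v.2.1 && decide (1 ≤ v.1) &&
      (letters d).all (fun a => termOK τ d N syms t v.2.1 a (v.2.2.getD (letterIdx a) none)) &&
      decide (lamD * rowValC τ kc d pn Q D t v.2.1 (fun k => v.2.2.getD k none) ≤ lamN * 2 * D ^ (8 * d + 1) * v.1)

end CheckC

section SoundC

variable {τ kc d N pn Q D lamN lamD : ℕ} {syms : List (List (ℕ × Bool))} {t : NT}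

/-- What a passed chain row check says. [folklore] -/
theorem checkRowC_spec {i : ℕ} (h : checkRowC τ kc d N pn Q D lamN lamD syms t i = true) :
    ∃ v, t.find i = some v ∧ WF d v.2.1 = true ∧ 1 ≤ v.1 ∧
      (∀ a, termOK τ d N syms t v.2.1 a (v.2.2.getD (letterIdx a) none) = true) ∧
      lamD * rowValC τ kc d pn Q D t v.2.1 (fun k => v.2.2.getD k none) ≤ lamN * 2 * D ^ (8 * d + 1) * v.1 := by
  unfold checkRowC at h
  cases hf : t.find i with
  | none => rw [hf] at h; exact Bool.noConfusion h
  | some v =>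
    rw [hf] at h
    simp only [Bool.and_eq_true, decide_eq_true_eq, List.all_eq_true] at h
    obtain ⟨⟨⟨hwf, hv⟩, hall⟩, hineq⟩ := h
    exact ⟨v, rfl, hwf, hv, fun a => hall a (mem_letters a), hineq⟩

/-- The real value of an integer chain term. [folklore] -/
theorem termValC_real_eq {u c F Vj : ℕ} (hu : u ≤ 4 * d) (hc : c ≤ 4 * d) (hD : (0 : ℝ) < D) :
    ((pn * Q ^ u * D ^ (4 * d - u) * F * D ^ (4 * d - c) * Vj : ℕ) : ℝ) / (2 * (D : ℝ) ^ (8 * d + 1)) =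
      (pn : ℝ) / D * ((Q : ℝ) / D) ^ u * ((F : ℝ) / (2 * (D : ℝ) ^ c)) * Vj := by
  have hsplit : (D : ℝ) ^ (8 * d + 1) = (D : ℝ) ^ (4 * d - u) * (D : ℝ) ^ u * ((D : ℝ) ^ (4 * d - c) * (D : ℝ) ^ c) * D := by
    rw [← pow_add, ← pow_add, ← pow_add, ← pow_succ]; congr 1; omega
  rw [hsplit, div_pow]
  push_cast
  field_simp

/-- **Soundness of the chain kernel certificate.**  If every row `i < N` passes `checkRowC`, row `0` carries the empty state, the
symmetry numbers denote lattice symmetries, and `pn ≤ D`, `Q ≤ D`, `(D - pn)·D^{2d-1} ≤ Q^{2d}` (`q̄^{2d} ≥ 1 - p`, `q̄ = Q/D`),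
`lamN < lamD`, then `pn / D ≤ p_c^site(ℤ^d)`. [folklore] -/
theorem le_siteCriticalProb_of_checkRowsC [NeZero d] (hτ : 2 ≤ τ) (sym : ℕ → SPerm d)
    (hsyms : ∀ c < syms.length, syms.getD c [] = spermKL (sym c))
    (hrows : ∀ i < N, checkRowC τ kc d N pn Q D lamN lamD syms t i = true)
    (hN : 0 < N) (h0 : stOf t 0 = []) (hD : 0 < D) (hpn : pn ≤ D) (hQ : Q ≤ D)
    (hq : (D - pn) * D ^ (2 * d - 1) ≤ Q ^ (2 * d)) (hlam : lamN < lamD) :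
    (pn : ℝ) / D ≤ siteCriticalProb (zdGraph d) 0 := by
  classical
  have hd : 1 ≤ d := NeZero.one_le
  have hDr : (0 : ℝ) < D := Nat.cast_pos.2 hD
  have hlamDr : (0 : ℝ) < lamD := Nat.cast_pos.2 (by omega)
  set p : unitInterval := ⟨(pn : ℝ) / D, div_nonneg (Nat.cast_nonneg _) hDr.le,
    div_le_one_of_le₀ (by exact_mod_cast hpn) hDr.le⟩ with hp
  set qb : ℝ := (Q : ℝ) / D with hqb
  set lam : ℝ := (lamN : ℝ) / lamD with hlamdef
  have hqb0 : 0 ≤ qb := div_nonneg (Nat.cast_nonneg _) hDr.le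
  have hQr : (Q : ℝ) ≤ D := by exact_mod_cast hQ
  have hqb1 : qb ≤ 1 := div_le_one_of_le₀ hQr hDr.le
  have hlam0 : 0 ≤ lam := div_nonneg (Nat.cast_nonneg _) hlamDr.le
  have hlam1 : lam < 1 := (div_lt_one hlamDr).2 (by exact_mod_cast hlam)
  have hpq : 1 - (p : ℝ) ≤ qb ^ (2 * d) := by
    have key : ((D : ℝ) - pn) * (D : ℝ) ^ (2 * d - 1) ≤ (Q : ℝ) ^ (2 * d) := by
      have h1 : (((D - pn : ℕ) : ℝ)) = (D : ℝ) - pn := Nat.cast_sub hpn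
      rw [← h1]; exact_mod_cast hq
    have e1 : 1 - (p : ℝ) = ((D : ℝ) - pn) / D := by
      show 1 - (pn : ℝ) / D = _; field_simp
    rw [e1, hqb, div_pow, div_le_div_iff₀ hDr (pow_pos hDr _)]
    have e2 : (D : ℝ) ^ (2 * d) = (D : ℝ) ^ (2 * d - 1) * D := by
      rw [← pow_succ]; congr 1; omega
    calc ((D : ℝ) - pn) * (D : ℝ) ^ (2 * d) = ((D : ℝ) - pn) * (D : ℝ) ^ (2 * d - 1) * D := by rw [e2]; ring
      _ ≤ (Q : ℝ) ^ (2 * d) * D := mul_le_mul_of_nonneg_right key hDr.le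
  -- the semantic table
  let R : Fin N → MState d := fun i => toM (stOf t i)
  let V : Fin N → ℝ := fun i => (vOf t i : ℝ)
  let sc : Fin N → Fin d × Bool → Option (Fin N × SPerm d) := fun i a =>
    match scOf t i (letterIdx a) with
    | none => none
    | some jc => if h : jc.1 < N then some ((⟨jc.1, h⟩ : Fin N), sym jc.2) else none
  have hrow : ∀ i : Fin N, ∃ v, t.find i = some v ∧ WF d v.2.1 = true ∧ 1 ≤ v.1 ∧
      (∀ a, termOK τ d N syms t v.2.1 a (v.2.2.getD (letterIdx a) none) = true) ∧
      lamD * rowValC τ kc d pn Q D t v.2.1 (fun k => v.2.2.getD k none) ≤ lamN * 2 * D ^ (8 * d + 1) * v.1 :=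
    fun i => checkRowC_spec (hrows i i.2)
  have hst : ∀ (i : Fin N) v, t.find i = some v → stOf t i = v.2.1 := fun i v h => by simp [stOf, h]
  have hv : ∀ (i : Fin N) v, t.find i = some v → vOf t i = v.1 := fun i v h => by simp [vOf, h]
  have hsc : ∀ (i : Fin N) v, t.find i = some v → ∀ k, scOf t i k = v.2.2.getD k none := fun i v h k => by
    simp [scOf, h]
  have hV : ∀ i, 1 ≤ V i := fun i => by
    obtain ⟨v, hf, -, hv1, -⟩ := hrow i
    show (1 : ℝ) ≤ (vOf t i : ℝ)
    rw [hv i v hf]; exact_mod_cast hv1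
  have h0' : R ⟨0, hN⟩ = ∅ := by
    show toM (stOf t 0) = (∅ : MState d)
    rw [h0]; rfl
  -- simulation (weight-independent: same proof as the B2r certificate)
  have hsim : ∀ i a, simRel R (nstep τ (R i) a) (sc i a) = true := by
    intro i a
    obtain ⟨v, hf, hwf, -, hok, -⟩ := hrow i
    have hRi : R i = toM v.2.1 := by show toM (stOf t i) = _; rw [hst i v hf]
    have hoka := hok a
    unfold termOK at hoka
    have hsci : sc i a = (match v.2.2.getD (letterIdx a) none with
        | none => none
        | some jc => if h : jc.1 < N then some ((⟨jc.1, h⟩ : Fin N), sym jc.2) else none) := by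
      show (match scOf t i (letterIdx a) with
        | none => none
        | some jc => if h : jc.1 < N then some ((⟨jc.1, h⟩ : Fin N), sym jc.2) else none) = _
      rw [hsc i v hf]
    rw [hRi, nstep_toM hwf, hsci]
    cases hT : nstepK τ d v.2.1 a with
    | none =>
      rw [hT] at hoka
      cases hos : v.2.2.getD (letterIdx a) none with
      | none => rfl
      | some jc => rw [hos] at hoka; exact Bool.noConfusion hoka
    | some T =>
      rw [hT] at hoka
      cases hos : v.2.2.getD (letterIdx a) none with
      | none => rw [hos] at hoka; exact Bool.noConfusion hoka
      | some jc =>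
        rw [hos] at hoka
        rcases jc with ⟨j, c⟩
        simp only [Bool.and_eq_true, decide_eq_true_eq] at hoka
        obtain ⟨⟨hjN, hc⟩, hseq⟩ := hoka
        simp only [Option.map_some, dif_pos hjN, simRel, decide_eq_true_eq]
        rw [toM_eq_of_seteqK hseq, hsyms c hc, toM_actK]
  -- Collatz–Wielandt rows
  have hcw : ∀ i, (∑ a : Fin d × Bool, match sc i a with
      | none => 0
      | some jg => (p : ℝ) * cwt τ kc qb (R i) a * V jg.1) ≤ lam * V i := by
    intro i
    obtain ⟨v, hf, hwf, hv1, hok, hineq⟩ := hrow i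
    have hRi : R i = toM v.2.1 := by show toM (stOf t i) = _; rw [hst i v hf]
    have hterm : ∀ a, (match sc i a with
        | none => 0
        | some jg => (p : ℝ) * cwt τ kc qb (R i) a * V jg.1) ≤
        (termValC τ kc d pn Q D t v.2.1 a (v.2.2.getD (letterIdx a) none) : ℝ) / (2 * (D : ℝ) ^ (8 * d + 1)) := by
      intro a
      have hoka := hok a
      unfold termOK at hoka
      have hsci : sc i a = (match v.2.2.getD (letterIdx a) none with
          | none => none
          | some jc => if h : jc.1 < N then some ((⟨jc.1, h⟩ : Fin N), sym jc.2) else none) := by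
        show (match scOf t i (letterIdx a) with
          | none => none
          | some jc => if h : jc.1 < N then some ((⟨jc.1, h⟩ : Fin N), sym jc.2) else none) = _
        rw [hsc i v hf]
      rw [hsci]
      cases hos : v.2.2.getD (letterIdx a) none with
      | none => simp only [termValC, Nat.cast_zero, zero_div, le_refl]
      | some jc =>
        rw [hos] at hoka
        cases hT : nstepK τ d v.2.1 a with
        | none => rw [hT] at hoka; exact Bool.noConfusion hoka
        | some T =>
          rw [hT] at hoka
          rcases jc with ⟨j, c⟩
          simp only [Bool.and_eq_true, decide_eq_true_eq] at hoka
          obtain ⟨⟨hjN, -⟩, -⟩ := hoka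
          simp only [dif_pos hjN, termValC]
          rw [termValC_real_eq (cuK_le _ _) (ccK_le _ _) hDr]
          have hVj : V ⟨j, hjN⟩ = (vOf t j : ℝ) := rfl
          rw [hVj, hRi, cwt, cuK_eq hwf, ccK_eq hwf]
          set u := cu τ kc (toM v.2.1 : MState d) a with hu
          set c' := cc τ kc (toM v.2.1 : MState d) a with hc'
          set FN : ℕ := if c' = 0 then 2 else D ^ c' + Q ^ c' with hFN
          have hF : (if c' = 0 then (1 : ℝ) else (1 + qb ^ c') / 2) = (FN : ℝ) / (2 * (D : ℝ) ^ c') := by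
            by_cases h0 : c' = 0
            · rw [if_pos h0, hFN, if_pos h0, h0, pow_zero]; norm_num
            · rw [if_neg h0, hFN, if_neg h0, hqb, div_pow]
              have hDc : (0 : ℝ) < (D : ℝ) ^ c' := pow_pos hDr _
              push_cast
              field_simp
          rw [hF]
          have hpv : (p : ℝ) = (pn : ℝ) / D := rfl
          rw [hpv, hqb]
          apply le_of_eq
          ring
    calc (∑ a : Fin d × Bool, match sc i a with
            | none => 0
            | some jg => (p : ℝ) * cwt τ kc qb (R i) a * V jg.1)
        ≤ ∑ a : Fin d × Bool, (termValC τ kc d pn Q D t v.2.1 a (v.2.2.getD (letterIdx a) none) : ℝ) /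
            (2 * (D : ℝ) ^ (8 * d + 1)) := Finset.sum_le_sum fun a _ => hterm a
      _ = (rowValC τ kc d pn Q D t v.2.1 (fun k => v.2.2.getD k none) : ℝ) / (2 * (D : ℝ) ^ (8 * d + 1)) := by
          rw [← Finset.sum_div, rowValC, ← sum_letters_eq, Nat.cast_list_sum, List.map_map]; rfl
      _ ≤ lam * V i := by
          rw [div_le_iff₀ (by positivity), hlamdef]
          show _ ≤ (lamN : ℝ) / lamD * (vOf t i : ℝ) * (2 * (D : ℝ) ^ (8 * d + 1))
          rw [hv i v hf, div_mul_eq_mul_div, div_mul_eq_mul_div, le_div_iff₀ hlamDr]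
          calc (rowValC τ kc d pn Q D t v.2.1 (fun k => v.2.2.getD k none) : ℝ) * lamD
              = ((lamD * rowValC τ kc d pn Q D t v.2.1 (fun k => v.2.2.getD k none) : ℕ) : ℝ) := by push_cast; ring
            _ ≤ ((lamN * 2 * D ^ (8 * d + 1) * v.1 : ℕ) : ℝ) := by exact_mod_cast hineq
            _ = (lamN : ℝ) * (v.1 : ℝ) * (2 * (D : ℝ) ^ (8 * d + 1)) := by push_cast; ring
  have main := le_siteCriticalProb_zd_of_chainMemTable (d := d) (kc := kc) hτ p hqb0 hqb1 hpq hlam0 hlam1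
    R sc V ⟨0, hN⟩ h0' hV hsim hcw
  exact main

end SoundC

end NawK

end Summit.CriticalPhenomena.PercolationContinuityZ3.Theorems.Pcint
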